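import Summits.HodgeConjecture.HodgeConjecture.Theorems.HeckePrymWeilWeilTwelvefoldsSqrtMinus7CmSurfaceDescentPairLemmas
import Summits.HodgeConjecture.HodgeConjecture.Theorems.HeckePrymWeilWeilTwelvefoldsSqrtMinus7Descent
import Summits.HodgeConjecture.HodgeConjecture.Theorems.HeckePrymWeilWeilTwelvefoldsSqrtMinus7HodgeTypeExterior
import Summits.HodgeConjecture.HodgeConjecture.Theorems.HeckePrymWeilIsoInvariance
import Literature.AlgebraicGeometry.HodgeTheory.TopDegreeClasses
import Literature.AlgebraicGeometry.HodgeTheory.CrossProductTopClass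
import Literature.NumberTheory.Transcendental.DeRhamTheoremMultiplicative
import HarnessLib

/-!
# Crux `WeilTwelvefoldsSqrtMinus7` (stmt-HodgeConjecture-1261), line `amnesic-secant-sheaves-split-fourteenfolds` — the CM Weil surface and its descent pair for EVERY `d ≥ 1`

Registered sub-goal `cmSurfaceDescentPair_general` (lead seat c1): the statement of the landed stub
`stub_cmSurfaceDescentPair` (T_B, `Theorems/HeckePrymWeilWeilTwelvefoldsSqrtMinus7CmSurfaceDescentPair`,
stub-worker of the lead, d = 7) with `7 ↦ d`, SAME proof (van Geemen, LNM 1594, 5.3: the partner surface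
`B = E × E` of the product trick with `K = ℚ(√-d)` acting by `(ι, ῑ)`; Schoen 1998 §10). For a complex elliptic
curve `E` (`dim E = 1`) with `φ ≫ φ = -d`, a rational basis `x₀, x₁` of `H¹(E(ℂ); ℂ)` on which `φ^*` has an
integer matrix, and `ω = x₀ ⌣ x₁ ≠ 0` spanning `H²`: `dim (E × E) = 2`, `ψ ≫ ψ = -d` for `ψ = (φ, -φ)`, and with
`w = x₁`, `u = φ^* w`, `v± = u ± i√d·w`: `b₊ = pr₁^*v₊ ⌣ pr₂^*v₋ ∈ Eig((𝟙+ψ)^*, (1+i√d)²)`,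
`b₋ = pr₁^*v₋ ⌣ pr₂^*v₊ ∈ Eig((𝟙+ψ)^*, (1-i√d)²)`, `b₊ + b₋` rational of Hodge type `(1,1)`, and the diagonal
class `η = (fst - snd)^*ω ∈ N¹H²` has `b± ⌣ η ≠ 0`. Together with `exists_cmCurveModel` (the CM curve
`ℂ/(ℤ + ℤ√-d)` with `[√-d]` and its model, every `d ≥ 1`) this is the PARTNER half of the named fact
`Motives.exists_cmWeilSurface_aimedSplitProduct_of_ne_one_of_ne_three` for every `d`.
-/

noncomputable section

set_option linter.dupNamespace false

open CategoryTheory Complex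
open Literature.AlgebraicGeometry Literature.AlgebraicGeometry.Motives
  Literature.AlgebraicGeometry.HodgeTheory Literature.AlgebraicTopology.SingularHomology

namespace Summit.HodgeConjecture.HodgeConjecture.Theorems.WeilTwelvefoldsSqrtMinus7.AmnesicSecantSheaves

/-! ## The curve: `φ^*` on `H¹(E(ℂ); ℂ)` for `φ ≫ φ = -d` -/

section Curve

variable {E : AbelianVariety ℂ} {φ : E ⟶ E}

/-- `φ^* φ^* = -d` on `H¹(E(ℂ); ℂ)` for `φ ≫ φ = -d`. [cite: vanGeemen1994HodgeAV, Lemma 5.3] -/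
theorem cmd_F_F {d : ℕ} (hφ : φ ≫ φ = -((d : ℤ) • 𝟙 E)) (v : complexBetti E.X 1) :
    complexBetti.map φ.hom.hom.hom 1 (complexBetti.map φ.hom.hom.hom 1 v) = (-(d : ℂ)) • v := by
  rw [← cm_map_comp, hφ, cm_map_neg, cm_map_zsmul, cm_map_id, ← Int.cast_smul_eq_zsmul ℂ, Int.cast_natCast,
    neg_smul]

/-- **The eigenvectors of `φ^*`**: `φ^*(φ^* w + t·w) = t·(φ^* w + t·w)` for `t² = -d`.
[cite: vanGeemen1994HodgeAV, Lemma 5.3] -/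
theorem cmd_eigen {d : ℕ} (hφ : φ ≫ φ = -((d : ℤ) • 𝟙 E)) (w : complexBetti E.X 1) {t : ℂ}
    (ht : t * t = -(d : ℂ)) :
    complexBetti.map φ.hom.hom.hom 1 (complexBetti.map φ.hom.hom.hom 1 w + t • w) =
      t • (complexBetti.map φ.hom.hom.hom 1 w + t • w) := by
  rw [map_add, map_smul, cmd_F_F hφ, smul_add, smul_smul, ht]
  abel

/-- Linear algebra: if `F w = u`, `F u = -d w` and `(u, w)` is a basis, every `t`-eigenvector of
`F` is a multiple of `u + t·w`. [folklore] -/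
theorem cmd_eigen_unique {V : Type*} [AddCommGroup V] [Module ℂ V] (F : V →ₗ[ℂ] V) {u w : V} {d : ℂ}
    (hFw : F w = u) (hFu : F u = (-d) • w)
    (hind : ∀ p q : ℂ, p • u + q • w = 0 → p = 0 ∧ q = 0) (hsp : ∀ v, ∃ p q : ℂ, v = p • u + q • w)
    {t : ℂ} {v : V} (hv : F v = t • v) : ∃ r : ℂ, v = r • (u + t • w) := by
  obtain ⟨p, q, rfl⟩ := hsp v
  refine ⟨p, ?_⟩
  have hF : F (p • u + q • w) = p • ((-d) • w) + q • u := by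
    rw [map_add, map_smul, map_smul, hFu, hFw]
  have key : (q - t * p) • u + (-d * p - t * q) • w = 0 := by
    have e : (q - t * p) • u + (-d * p - t * q) • w =
        (p • ((-d) • w) + q • u) - t • (p • u + q • w) := by module
    rw [e, ← hF, hv, sub_self]
  obtain ⟨h1, -⟩ := hind _ _ key
  rw [sub_eq_zero.1 h1]
  module

end Curve

/-! ## The surface `E × E`: `(𝟙 + ψ)^*` factorwise, rationality, the diagonal class -/

section Surface

variable {E : AbelianVariety ℂ}

/-- **`(𝟙 + ψ)^*` on cross products, factorwise**, `ψ = (φ, -φ)`: if `φ^* v = t v` and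
`φ^* v' = t' v'` in `H¹(E(ℂ); ℂ)` then
`(𝟙+ψ)^*(pr₁^* v ⌣ pr₂^* v') = (1 + t)(1 - t') · pr₁^* v ⌣ pr₂^* v'` — naturality of `⌣`,
`(𝟙+ψ) ≫ pr₁ = pr₁ ≫ (𝟙+φ)`, `(𝟙+ψ) ≫ pr₂ = pr₂ ≫ (𝟙-φ)`, additivity on `H¹`.
[cite: vanGeemen1994HodgeAV, Lemma 5.2] [cite: HatcherAT2002, Prop. 3.10] -/
theorem cmd_T_cross (φ : E ⟶ E) {v v' : complexBetti E.X 1} {t t' : ℂ}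
    (hv : complexBetti.map φ.hom.hom.hom 1 v = t • v) (hv' : complexBetti.map φ.hom.hom.hom 1 v' = t' • v') :
    complexBetti.map (𝟙 (E.prod E) + AbelianVariety.prodLift (AbelianVariety.fst E E ≫ φ)
        (AbelianVariety.snd E E ≫ (-φ))).hom.hom.hom 2
      (cupProduct (rfl : 1 + 1 = 2) (complexBetti.map (AbelianVariety.fst E E).hom.hom.hom 1 v)
        (complexBetti.map (AbelianVariety.snd E E).hom.hom.hom 1 v')) =
    ((1 + t) * (1 - t')) • cupProduct (rfl : 1 + 1 = 2)
      (complexBetti.map (AbelianVariety.fst E E).hom.hom.hom 1 v)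
      (complexBetti.map (AbelianVariety.snd E E).hom.hom.hom 1 v') := by
  set g : E.prod E ⟶ E.prod E := 𝟙 (E.prod E) +
    AbelianVariety.prodLift (AbelianVariety.fst E E ≫ φ) (AbelianVariety.snd E E ≫ (-φ)) with hg
  have hg₁ : g ≫ AbelianVariety.fst E E = AbelianVariety.fst E E ≫ (𝟙 E + φ) := by
    simp [hg, Preadditive.add_comp, Preadditive.comp_add]
  have hg₂ : g ≫ AbelianVariety.snd E E = AbelianVariety.snd E E ≫ (𝟙 E + (-φ)) := by
    simp [hg, Preadditive.add_comp, Preadditive.comp_add]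
  have h1 : complexBetti.map (𝟙 E + φ).hom.hom.hom 1 v = (1 + t) • v := by
    rw [cm_map_add, cm_map_id, hv, add_smul, one_smul]
  have h2 : complexBetti.map (𝟙 E + (-φ)).hom.hom.hom 1 v' = (1 - t') • v' := by
    rw [cm_map_add, cm_map_neg, cm_map_id, hv', sub_smul, one_smul, sub_eq_add_neg]
  change singularCohomology.map ℂ ℂ (AlgPoints.mapContinuous (L := ℂ) g.hom.hom.hom) 2 _ = _
  rw [cupProduct_map, map_map_eq_of_comp_eq hg₁, map_map_eq_of_comp_eq hg₂, h1, h2]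
  simp only [map_smul, LinearMap.smul_apply, smul_smul, mul_comm]

/-- **`b₊ + b₋` is rational**: for rational `u, w ∈ H¹(E(ℂ); ℂ)` and `s² = -d`,
`pr₁^*(u + s w) ⌣ pr₂^*(u - s w) + pr₁^*(u - s w) ⌣ pr₂^*(u + s w) = 2·pr₁^*u ⌣ pr₂^*u + 2d·pr₁^*w ⌣ pr₂^*w`.
[cite: vanGeemen1994HodgeAV, Lemma 5.2] [cite: HatcherAT2002, §3.1 p. 198] -/
theorem cmd_rational {d : ℕ} {u w : complexBetti E.X 1} (hu : IsRationalClass u) (hw : IsRationalClass w) {s : ℂ}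
    (hs : s * s = -(d : ℂ)) :
    IsRationalClass
      (cupProduct (rfl : 1 + 1 = 2) (complexBetti.map (AbelianVariety.fst E E).hom.hom.hom 1 (u + s • w))
          (complexBetti.map (AbelianVariety.snd E E).hom.hom.hom 1 (u + (-s) • w)) +
        cupProduct (rfl : 1 + 1 = 2) (complexBetti.map (AbelianVariety.fst E E).hom.hom.hom 1 (u + (-s) • w))
          (complexBetti.map (AbelianVariety.snd E E).hom.hom.hom 1 (u + s • w))) := by
  have e : cupProduct (rfl : 1 + 1 = 2) (complexBetti.map (AbelianVariety.fst E E).hom.hom.hom 1 (u + s • w))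
          (complexBetti.map (AbelianVariety.snd E E).hom.hom.hom 1 (u + (-s) • w)) +
        cupProduct (rfl : 1 + 1 = 2) (complexBetti.map (AbelianVariety.fst E E).hom.hom.hom 1 (u + (-s) • w))
          (complexBetti.map (AbelianVariety.snd E E).hom.hom.hom 1 (u + s • w)) =
      ((2 : ℚ) : ℂ) • cupProduct (rfl : 1 + 1 = 2) (complexBetti.map (AbelianVariety.fst E E).hom.hom.hom 1 u)
          (complexBetti.map (AbelianVariety.snd E E).hom.hom.hom 1 u) +
        ((2 * d : ℚ) : ℂ) • cupProduct (rfl : 1 + 1 = 2) (complexBetti.map (AbelianVariety.fst E E).hom.hom.hom 1 w)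
          (complexBetti.map (AbelianVariety.snd E E).hom.hom.hom 1 w) := by
    have h14 : ((2 * d : ℚ) : ℂ) = -(2 * (s * s)) := by rw [hs]; push_cast; ring
    have h2 : ((2 : ℚ) : ℂ) = 2 := by norm_num
    rw [h14, h2]
    simp only [map_add, map_smul, LinearMap.add_apply, LinearMap.smul_apply]
    module
  rw [e]
  exact (((hu.map _).cup _ (hu.map _)).smul 2).add (((hw.map _).cup _ (hw.map _)).smul (2 * d))

/-- **The diagonal class `η = (pr₁ - pr₂)^* ω` is algebraic** for every `ω ∈ H²(E(ℂ); ℂ)` of the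
curve `E`: `pr₁ - pr₂ = σ ≫ pr₂` for the involution `σ = (pr₁, pr₁ - pr₂)` of `E × E`, top-degree
classes are algebraic, and `pr₂^*`, `σ^*` transport algebraic classes (`σ` is an isomorphism of
`ℂ`-schemes, in particular an open immersion).
[cite: VoisinHodgeII2003, Prop. 9.21 (i) and §10.2.3] [cite: Fulton1998, §19.1] -/
theorem cmd_eta_mem (hE : IsSmoothProjective 1 E.X) (ω : complexBetti E.X 2) :
    complexBetti.map (AbelianVariety.fst E E - AbelianVariety.snd E E).hom.hom.hom 2 ω ∈
      algebraicClasses (E.prod E).X 1 := by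
  set σ : E.prod E ⟶ E.prod E :=
    AbelianVariety.prodLift (AbelianVariety.fst E E) (AbelianVariety.fst E E - AbelianVariety.snd E E) with hσ
  have hσσ : σ ≫ σ = 𝟙 (E.prod E) := by
    apply AbelianVariety.prod_hom_ext
    · rw [Category.assoc, hσ, AbelianVariety.prodLift_fst, AbelianVariety.prodLift_fst, Category.id_comp]
    · rw [Category.assoc, hσ, AbelianVariety.prodLift_snd, Preadditive.comp_sub, AbelianVariety.prodLift_fst,
        AbelianVariety.prodLift_snd, Category.id_comp, sub_sub_cancel]
  haveI : IsIso σ.hom.hom.hom.left :=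
    ⟨⟨σ.hom.hom.hom.left,
      by change (σ ≫ σ).hom.hom.hom.left = _; rw [hσσ]; rfl,
      by change (σ ≫ σ).hom.hom.hom.left = _; rw [hσσ]; rfl⟩⟩
  have hω : ω ∈ algebraicClasses E.X 1 := mem_algebraicClasses_of_degree_top hE le_rfl ω
  rw [show AbelianVariety.fst E E - AbelianVariety.snd E E = σ ≫ AbelianVariety.snd E E from
    (AbelianVariety.prodLift_snd _ _).symm, cm_map_comp]
  exact map_mem_supportedClasses_of_isOpenImmersion_left σ.hom.hom.hom (map_snd_mem_supportedClasses hE hE hω)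

/-- **`b ⌣ η ≠ 0`** for `b = pr₁^* v ⌣ pr₂^* v'` with `v ⌣ v' ≠ 0`, `ω ≠ 0` of top degree on the curve,
and `η = (pr₁ - pr₂)^* ω`: pulling back along the involution `σ = (pr₁, pr₁ - pr₂)` of `E × E`
(`σ ≫ pr₁ = pr₁`, `σ ≫ pr₂ = pr₁ - pr₂`, `σ ≫ (pr₁ - pr₂) = pr₂`) gives
`σ^*(b ⌣ η) = (pr₁^* v ⌣ (pr₁^* v' - pr₂^* v')) ⌣ pr₂^* ω = pr₁^*(v ⌣ v') ⌣ pr₂^* ω`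
(`(pr₁^* v ⌣ pr₂^* v') ⌣ pr₂^* ω = pr₁^* v ⌣ pr₂^*(v' ⌣ ω) = 0`, `H³` of a curve vanishes), which
is non-zero (`cupProduct_map_fst_map_snd_ne_zero`). [cite: Schoen1998HodgeWeilAddendum, §10]
[cite: HatcherAT2002, Prop. 3.10 and §3.2 p. 211] [cite: FultonYoungTableaux1997, Appendix B §B.1 (6)] -/
theorem cmd_cup_eta_ne_zero (μ : OrientationFamily) (hE : IsSmoothProjective 1 E.X)
    {v v' : complexBetti E.X 1} {ω : complexBetti E.X 2}
    (hvv' : cupProduct (rfl : 1 + 1 = 2) v v' ≠ 0) (hω : ω ≠ 0) :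
    cupProduct (show 2 + 2 = 4 from rfl)
        (cupProduct (rfl : 1 + 1 = 2) (complexBetti.map (AbelianVariety.fst E E).hom.hom.hom 1 v)
          (complexBetti.map (AbelianVariety.snd E E).hom.hom.hom 1 v'))
        (complexBetti.map (AbelianVariety.fst E E - AbelianVariety.snd E E).hom.hom.hom 2 ω) ≠ 0 := by
  haveI := subsingleton_complexBetti hE (show 2 * 1 < 3 by norm_num)
  set σ : E.prod E ⟶ E.prod E :=
    AbelianVariety.prodLift (AbelianVariety.fst E E) (AbelianVariety.fst E E - AbelianVariety.snd E E) with hσ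
  have hσ₁ : σ ≫ AbelianVariety.fst E E = AbelianVariety.fst E E := AbelianVariety.prodLift_fst _ _
  have hσ₂ : σ ≫ AbelianVariety.snd E E = AbelianVariety.fst E E - AbelianVariety.snd E E :=
    AbelianVariety.prodLift_snd _ _
  have hσ₃ : σ ≫ (AbelianVariety.fst E E - AbelianVariety.snd E E) = AbelianVariety.snd E E := by
    rw [Preadditive.comp_sub, hσ₁, hσ₂, sub_sub_cancel]
  have h3 : cupProduct (rfl : 1 + 2 = 3) v' ω = 0 := Subsingleton.elim _ _
  intro h
  have h' := congrArg (complexBetti.map σ.hom.hom.hom 4) h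
  rw [map_zero, cm_map_cup, cm_map_cup, ← cm_map_comp, ← cm_map_comp, ← cm_map_comp, hσ₁, hσ₂, hσ₃,
    cm_map_sub, map_sub, LinearMap.map_sub₂, ← cm_map_cup,
    cupProduct_assoc (rfl : 1 + 1 = 2) (rfl : 1 + 2 = 3) (show 2 + 2 = 4 from rfl) (show 1 + 3 = 4 from rfl),
    ← cm_map_cup, h3, map_zero, map_zero, sub_zero] at h'
  exact cupProduct_map_fst_map_snd_ne_zero μ hE hE (show 2 + 2 * 1 = 4 from rfl) hvv' hω h'

end Surface

/-! ## The stub -/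

/-- **The CM Weil surface `E × E`, `ψ = (φ, -φ)`, and its descent pair, for every `d ≥ 1`** (the landed
stub `stub_cmSurfaceDescentPair` of this crux's line with `7 ↦ d`; registered sub-goal
`cmSurfaceDescentPair_general`). For a complex elliptic curve `E` of dimension `1` with `φ ≫ φ = -d`, a
rational basis `x₀, x₁` of `H¹(E(ℂ); ℂ)` on which `φ^*` has an integer matrix, and `ω = x₀ ⌣ x₁ ≠ 0` spanning
`H²`: `dim (E × E) = 2`, `ψ ≫ ψ = -d`, and with `w = x₁`, `u = φ^* w`, `v± = u ± i√d·w`: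
`b₊ = pr₁^*v₊ ⌣ pr₂^*v₋ ∈ Eig((𝟙+ψ)^*, (1+i√d)²)`, `b₋ = pr₁^*v₋ ⌣ pr₂^*v₊ ∈ Eig((𝟙+ψ)^*, (1-i√d)²)`,
`b₊ + b₋` rational of Hodge type `(1,1)`, `η = (fst - snd)^*ω ∈ N¹H²`, `b± ⌣ η ≠ 0`.
[cite: vanGeemen1994HodgeAV, Lemma 5.2 and 5.3] [cite: Schoen1998HodgeWeilAddendum, §10] -/
theorem cmSurfaceDescentPair_general (d : ℕ) (hd : 0 < d) :
    ∀ (E : AbelianVariety ℂ) (φ : E ⟶ E), E.dim = 1 → φ ≫ φ = -((d : ℤ) • 𝟙 E) →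
    ∀ (x : Fin 2 → complexBetti E.X 1) (M : Matrix (Fin 2) (Fin 2) ℤ),
      (∀ i, IsRationalClass (x i)) → LinearIndependent ℂ x → Submodule.span ℂ (Set.range x) = ⊤ →
      (∀ i, complexBetti.map φ.hom.hom.hom 1 (x i) = ∑ j, ((M j i : ℤ) : ℂ) • x j) →
      (∀ (T : AbelianVariety ℂ) (f g : T ⟶ E) (i : Fin 2),
        complexBetti.map (f + g).hom.hom.hom 1 (x i) =
          complexBetti.map f.hom.hom.hom 1 (x i) + complexBetti.map g.hom.hom.hom 1 (x i)) →
      cupProduct (rfl : 1 + 1 = 2) (x 0) (x 1) ≠ 0 →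
      (∀ c : complexBetti E.X 2, ∃ t : ℂ, c = t • cupProduct (rfl : 1 + 1 = 2) (x 0) (x 1)) →
      (E.prod E).dim = 2 ∧
      AbelianVariety.prodLift (AbelianVariety.fst E E ≫ φ) (AbelianVariety.snd E E ≫ (-φ)) ≫
        AbelianVariety.prodLift (AbelianVariety.fst E E ≫ φ) (AbelianVariety.snd E E ≫ (-φ)) =
          -((d : ℤ) • 𝟙 (E.prod E)) ∧
      ∃ bp bm η : complexBetti (E.prod E).X 2,
        bp ∈ Module.End.eigenspace (complexBetti.map (𝟙 (E.prod E) +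
              AbelianVariety.prodLift (AbelianVariety.fst E E ≫ φ) (AbelianVariety.snd E E ≫ (-φ))).hom.hom.hom 2).hom
              ((1 + Complex.I * (Real.sqrt (d : ℝ) : ℂ)) ^ 2) ∧
        bm ∈ Module.End.eigenspace (complexBetti.map (𝟙 (E.prod E) +
              AbelianVariety.prodLift (AbelianVariety.fst E E ≫ φ) (AbelianVariety.snd E E ≫ (-φ))).hom.hom.hom 2).hom
              ((1 - Complex.I * (Real.sqrt (d : ℝ) : ℂ)) ^ 2) ∧
        IsRationalClass (bp + bm) ∧ IsOfHodgeType 2 (E.prod E).X 2 1 1 (bp + bm) ∧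
        η ∈ algebraicClasses (E.prod E).X 1 ∧
        cupProduct (show 2 + 2 = 4 from rfl) bp η ≠ 0 ∧
        cupProduct (show 2 + 2 = 4 from rfl) bm η ≠ 0 := by
  intro E φ hE hφ x M hrat hli hspan hM _ hω _
  have hE' : IsSmoothProjective 1 E.X := isSmoothProjective_of_dim_eq hE
  have hEE : IsSmoothProjective 2 (E.prod E).X :=
    isSmoothProjective_of_dim_eq (by rw [AbelianVariety.dim_prod, hE])
  -- `ℂ`-orientations of the complex points of all smooth projective varieties
  let μ : OrientationFamily := fun _ _ h ↦ Classical.choice (Motives.ComplexPoints.isOrientableOver ℂ h)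
  -- the constant `s = i√d`
  set s : ℂ := Complex.I * (Real.sqrt (d : ℝ) : ℂ) with hsdef
  have hs2 : s * s = -(d : ℂ) := by
    rw [hsdef, mul_mul_mul_comm, Complex.I_mul_I, ← Complex.ofReal_mul,
      Real.mul_self_sqrt (Nat.cast_nonneg d), Complex.ofReal_natCast]; ring
  have hs2' : (-s) * (-s) = -(d : ℂ) := by rw [neg_mul_neg, hs2]
  have hs0 : s ≠ 0 := mul_ne_zero Complex.I_ne_zero (by
    rw [Ne, Complex.ofReal_eq_zero]; exact (Real.sqrt_pos.2 (by exact_mod_cast hd)).ne')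
  -- linear independence of `x₀, x₁`, spanning
  have hli2 : ∀ p q : ℂ, p • x 0 + q • x 1 = 0 → p = 0 ∧ q = 0 := fun p q h ↦ by
    have h' := Fintype.linearIndependent_iff.1 hli ![p, q] (by simpa [Fin.sum_univ_two] using h)
    exact ⟨by simpa using h' 0, by simpa using h' 1⟩
  have hsp2 : ∀ v : complexBetti E.X 1, ∃ p q : ℂ, v = p • x 0 + q • x 1 := fun v ↦ by
    have hv : v ∈ Submodule.span ℂ (Set.range x) := by rw [hspan]; trivial
    obtain ⟨c, hc⟩ := (Submodule.mem_span_range_iff_exists_fun ℂ).1 hv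
    exact ⟨c 0, c 1, by rw [← hc, Fin.sum_univ_two]⟩
  -- `u = φ^* x₁ = M₀₁ x₀ + M₁₁ x₁`, `φ^* u = -d x₁`
  set F : complexBetti E.X 1 →ₗ[ℂ] complexBetti E.X 1 := (complexBetti.map φ.hom.hom.hom 1).hom with hFdef
  set u : complexBetti E.X 1 := complexBetti.map φ.hom.hom.hom 1 (x 1) with hudef
  have hu : u = ((M 0 1 : ℤ) : ℂ) • x 0 + ((M 1 1 : ℤ) : ℂ) • x 1 := by rw [hudef, hM, Fin.sum_univ_two]
  have hFw : F (x 1) = u := rfl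
  have hFu : F u = (-(d : ℂ)) • x 1 := cmd_F_F hφ _
  have hw0 : x 1 ≠ 0 := hli.ne_zero 1
  -- `M₀₁ ≠ 0`: otherwise `x₁` is an eigenvector of `φ^*` with the integer eigenvalue `M₁₁` of square `-d`
  have hb : ((M 0 1 : ℤ) : ℂ) ≠ 0 := by
    intro hb0
    have hu' : u = ((M 1 1 : ℤ) : ℂ) • x 1 := by rw [hu, hb0, zero_smul, zero_add]
    have hFu' : F u = ((M 1 1 : ℤ) : ℂ) • (((M 1 1 : ℤ) : ℂ) • x 1) := by rw [hu', map_smul, hFw, hu']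
    have h1 : (((M 1 1 : ℤ) : ℂ) * ((M 1 1 : ℤ) : ℂ) + (d : ℂ)) • x 1 = 0 := by
      have e : (((M 1 1 : ℤ) : ℂ) * ((M 1 1 : ℤ) : ℂ) + (d : ℂ)) • x 1 =
          ((M 1 1 : ℤ) : ℂ) • (((M 1 1 : ℤ) : ℂ) • x 1) - (-(d : ℂ)) • x 1 := by module
      rw [e, ← hFu', hFu, sub_self]
    have h2 : ((M 1 1 : ℤ) : ℂ) * ((M 1 1 : ℤ) : ℂ) + (d : ℂ) = 0 := (smul_eq_zero.1 h1).resolve_right hw0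
    have h3 : ((M 1 1 * M 1 1 + (d : ℤ) : ℤ) : ℂ) = 0 := by push_cast; exact h2
    have h4 : M 1 1 * M 1 1 + (d : ℤ) = 0 := by exact_mod_cast h3
    have h5 : (0 : ℤ) < d := by exact_mod_cast hd
    linarith [mul_self_nonneg (M 1 1)]
  have hind : ∀ p q : ℂ, p • u + q • x 1 = 0 → p = 0 ∧ q = 0 := by
    intro p q h
    rw [hu, smul_add, smul_smul, smul_smul, add_assoc, ← add_smul] at h
    obtain ⟨h1, h2⟩ := hli2 _ _ h
    have hp : p = 0 := (mul_eq_zero.1 h1).resolve_right hb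
    refine ⟨hp, ?_⟩
    rw [hp, zero_mul, zero_add] at h2
    exact h2
  have hsp : ∀ v : complexBetti E.X 1, ∃ p q : ℂ, v = p • u + q • x 1 := by
    intro v
    obtain ⟨p, q, rfl⟩ := hsp2 v
    refine ⟨p * ((M 0 1 : ℤ) : ℂ)⁻¹, q - p * ((M 0 1 : ℤ) : ℂ)⁻¹ * ((M 1 1 : ℤ) : ℂ), ?_⟩
    rw [hu, smul_add, smul_smul, smul_smul, inv_mul_cancel_right₀ hb]
    module
  -- the eigenvectors `v± = u ± s x₁`
  have hvp : complexBetti.map φ.hom.hom.hom 1 (u + s • x 1) = s • (u + s • x 1) := cmd_eigen hφ (x 1) hs2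
  have hvm : complexBetti.map φ.hom.hom.hom 1 (u + (-s) • x 1) = (-s) • (u + (-s) • x 1) :=
    cmd_eigen hφ (x 1) hs2'
  have hvp0 : u + s • x 1 ≠ 0 := fun h ↦ one_ne_zero (hind 1 s (by rwa [one_smul])).1
  have hvm0 : u + (-s) • x 1 ≠ 0 := fun h ↦ one_ne_zero (hind 1 (-s) (by rwa [one_smul])).1
  have hEp : ∀ v : complexBetti E.X 1, complexBetti.map φ.hom.hom.hom 1 v = s • v →
      ∃ r : ℂ, v = r • (u + s • x 1) := fun v hv ↦ cmd_eigen_unique F hFw hFu hind hsp hv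
  have hEm : ∀ v : complexBetti E.X 1, complexBetti.map φ.hom.hom.hom 1 v = (-s) • v →
      ∃ r : ℂ, v = r • (u + (-s) • x 1) := fun v hv ↦ cmd_eigen_unique F hFw hFu hind hsp hv
  have hFF : ∀ v : complexBetti E.X 1,
      complexBetti.map φ.hom.hom.hom 1 (complexBetti.map φ.hom.hom.hom 1 v) = (s * s) • v := fun v ↦ by
    rw [cmd_F_F hφ, hs2]
  -- Hodge types of `v±`
  have hH := cm_hodgeTypes_of_eigen hE' hs0 hFF hvp0 hvm0 hEp hEm (hrat 0) (hli.ne_zero 0)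
  -- `v₊ ⌣ v₋ = -2 s M₀₁ ω ≠ 0`, `v₋ ⌣ v₊ = 2 s M₀₁ ω ≠ 0`
  have huw : cupProduct (rfl : 1 + 1 = 2) u (x 1) =
      ((M 0 1 : ℤ) : ℂ) • cupProduct (rfl : 1 + 1 = 2) (x 0) (x 1) := by
    rw [hu, LinearMap.map_add₂, LinearMap.map_smul₂, LinearMap.map_smul₂, cm_cup_self, smul_zero, add_zero]
  have hpm : cupProduct (rfl : 1 + 1 = 2) (u + s • x 1) (u + (-s) • x 1) ≠ 0 := by
    rw [cm_cup_conj, huw, smul_smul]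
    exact smul_ne_zero (mul_ne_zero (neg_ne_zero.2 (mul_ne_zero two_ne_zero hs0)) hb) hω
  have hmp : cupProduct (rfl : 1 + 1 = 2) (u + (-s) • x 1) (u + s • x 1) ≠ 0 := by
    have e := cm_cup_conj u (x 1) (-s)
    rw [neg_neg] at e
    rw [e, huw, smul_smul]
    exact smul_ne_zero (mul_ne_zero (neg_ne_zero.2 (mul_ne_zero two_ne_zero (neg_ne_zero.2 hs0))) hb) hω
  -- Künneth for Hodge types (de Rham's theorem discharges the antecedent of `stub_hodgeTypeExterior`)
  have hdR : ∀ (V : Type) [NormedAddCommGroup V] [NormedSpace ℂ V] [FiniteDimensional ℂ V],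
      Literature.NumberTheory.Transcendental.exists_deRhamIsoFamily (modelWithCornersSelf ℝ V) :=
    fun V _ _ _ ↦ Literature.NumberTheory.Transcendental.exists_deRhamIsoFamily_holds V
  have hX : ∀ {p q p' q' : ℕ} {c c' : complexBetti E.X 1},
      IsOfHodgeType 1 E.X 1 p q c → IsOfHodgeType 1 E.X 1 p' q' c' →
      IsOfHodgeType 2 (E.prod E).X 2 (p + p') (q + q')
        (cupProduct (rfl : 1 + 1 = 2) (complexBetti.map (AbelianVariety.fst E E).hom.hom.hom 1 c)
          (complexBetti.map (AbelianVariety.snd E E).hom.hom.hom 1 c')) :=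
    fun hc hc' ↦ stub_hodgeTypeExterior hdR E E 1 1 hE hE 1 1 2 rfl _ _ _ _ _ _ hc hc'
  -- the witnesses
  refine ⟨by rw [AbelianVariety.dim_prod, hE], ?_,
    cupProduct (rfl : 1 + 1 = 2) (complexBetti.map (AbelianVariety.fst E E).hom.hom.hom 1 (u + s • x 1))
      (complexBetti.map (AbelianVariety.snd E E).hom.hom.hom 1 (u + (-s) • x 1)),
    cupProduct (rfl : 1 + 1 = 2) (complexBetti.map (AbelianVariety.fst E E).hom.hom.hom 1 (u + (-s) • x 1))
      (complexBetti.map (AbelianVariety.snd E E).hom.hom.hom 1 (u + s • x 1)),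
    complexBetti.map (AbelianVariety.fst E E - AbelianVariety.snd E E).hom.hom.hom 2
      (cupProduct (rfl : 1 + 1 = 2) (x 0) (x 1)),
    ?_, ?_, ?_, ?_, cmd_eta_mem hE' _, cmd_cup_eta_ne_zero μ hE' hpm hω, cmd_cup_eta_ne_zero μ hE' hmp hω⟩
  · -- `ψ ≫ ψ = -d`
    apply AbelianVariety.prod_hom_ext
    · rw [Category.assoc, AbelianVariety.prodLift_fst, ← Category.assoc, AbelianVariety.prodLift_fst,
        Category.assoc, hφ, Preadditive.comp_neg, Preadditive.comp_zsmul, Category.comp_id,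
        Preadditive.neg_comp, Preadditive.zsmul_comp, Category.id_comp]
    · rw [Category.assoc, AbelianVariety.prodLift_snd, ← Category.assoc, AbelianVariety.prodLift_snd,
        Category.assoc, Preadditive.neg_comp_neg, hφ, Preadditive.comp_neg, Preadditive.comp_zsmul,
        Category.comp_id, Preadditive.neg_comp, Preadditive.zsmul_comp, Category.id_comp]
  · -- `b₊ ∈ Eig((𝟙+ψ)^*, (1+s)²)`
    refine Module.End.mem_eigenspace_iff.2 ((cmd_T_cross φ hvp hvm).trans ?_)
    congr 1
    rw [hsdef]
    ring
  · -- `b₋ ∈ Eig((𝟙+ψ)^*, (1-s)²)`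
    refine Module.End.mem_eigenspace_iff.2 ((cmd_T_cross φ hvm hvp).trans ?_)
    congr 1
    rw [hsdef]
    ring
  · -- rationality
    exact cmd_rational ((hrat 1).map _) (hrat 1) hs2
  · -- Hodge type `(1,1)`
    rcases hH with ⟨hp, hm⟩ | ⟨hp, hm⟩
    · have h₁ := hX hp hm
      have h₂ := hX hm hp
      exact h₁.add hEE h₂
    · have h₁ := hX hp hm
      have h₂ := hX hm hp
      exact h₁.add hEE h₂

end Summit.HodgeConjecture.HodgeConjecture.Theorems.WeilTwelvefoldsSqrtMinus7.AmnesicSecantSheaves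

end
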